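import Literature.NumberTheory.LFunctions.SatheSelbergEulerProduct
import Mathlib.Analysis.Complex.Liouville
import Mathlib.Analysis.Calculus.DiffContOnCl
import HarnessLib

/-!
# The Euler product `F(s, z)` of `∑ z^{ω(n)} n^{-s}` near `s = 1`, and at `s = 1`

Support file for the Sathe–Selberg formula (`SatheSelberg.lean`,
`Literature.NumberTheory.LFunctions.MontgomeryVaughan2007_exercise_7_4_3c`), continuing
`SatheSelbergEulerProduct.lean` (MV §7.4.1 Exercise 3 (a), (b), (d)). Everything here is PROVED
(theorems only):

* `exists_lipschitz_selbergF` — `‖F(s, z) − F(1, z)‖ ≤ B′_R ‖s − 1‖` for `‖s − 1‖ ≤ 1/8`, `‖z‖ ≤ R`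
  (Cauchy's estimate for `∂F/∂s` from the uniform bound, and the mean value inequality): the input
  "`ζ(s)^z F(s,z)/s = (s − 1)^{−z}(F(1,z)/… + O(|s − 1|))`" of MV p. 178;
* `differentiable_selbergF_param` — `z ↦ F(s, z)` is entire (`σ > 1/2`);
* `prod_eulerFactor_one_ofReal` — at `s = 1` and real `z = r` the partial products are the real
  products `satheSelbergF x r = ∏_{p ≤ x} (1 + r/(p − 1))(1 − 1/p)^r` of `SatheSelberg.lean`;
* `exists_norm_selbergF_one_sub_prod_le` — the tail: `F(1, z) = (∏_{p ≤ x} E_p(1, z)) · T_x(z)` with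
  `‖T_x(z) − 1‖ ≤ C_R x^{−1/2}` (`x ≥ x₀(R)`);
* `selbergF_one_ofReal_im`, `selbergF_one_ofReal_re_pos`, `exists_pos_le_selbergF_one_re` — for real
  `r ≥ 0`, `F(1, r)` is a positive real, bounded below on `[0, R]` (so that `G(r) = F(1,r)/Γ(r+1) > 0`,
  MV Exercise 7.4.1.3 (d) `G(0) = G(1) = 1` being the special values).

## References

* [MontgomeryVaughan2007] H. L. Montgomery, R. C. Vaughan, *Multiplicative Number Theory I*,
  CUP 2007, §7.4.1 Exercise 3, and §7.4 p. 178.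
-/

noncomputable section

open Complex Filter Topology Metric Finset Set

namespace Literature.NumberTheory.LFunctions

namespace SatheSelberg

/-! ### Lipschitz bound at `s = 1`, uniformly in `‖z‖ ≤ R` -/

/-- **`F(s, z) = F(1, z) + O_R(|s − 1|)` near `s = 1`**: for every `R` there is `B′` such that
`‖F(s, z) − F(1, z)‖ ≤ B′ ‖s − 1‖` whenever `‖s − 1‖ ≤ 1/8` and `‖z‖ ≤ R` (Cauchy's estimate on
circles of radius `1/16` inside `σ ≥ 3/4`, where `‖F‖ ≤ B_R`, and the mean value inequality on
the convex ball). [cite: MontgomeryVaughan2007, §7.4 p. 178] -/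
theorem exists_lipschitz_selbergF (R : ℝ) :
    ∃ B' : ℝ, 0 ≤ B' ∧ ∀ s z : ℂ, ‖s - 1‖ ≤ 1 / 8 → ‖z‖ ≤ R →
      ‖selbergF s z - selbergF 1 z‖ ≤ B' * ‖s - 1‖ := by
  obtain ⟨B, hB, hbound⟩ := exists_bound_selbergF (by norm_num : (1 : ℝ) / 2 < 3 / 4) R
  refine ⟨B / (1 / 16), by positivity, fun s z hs hz ↦ ?_⟩
  set f : ℂ → ℂ := fun w ↦ selbergF w z with hf
  have hdiff : DifferentiableOn ℂ f {w : ℂ | 1 / 2 < w.re} := differentiableOn_selbergF z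
  -- derivative bound on the closed ball `‖w − 1‖ ≤ 1/8`
  have hderiv : ∀ c ∈ closedBall (1 : ℂ) (1 / 8), ‖deriv f c‖ ≤ B / (1 / 16) := by
    intro c hc
    have hc' : ‖c - 1‖ ≤ 1 / 8 := by simpa [dist_eq_norm] using hc
    refine norm_deriv_le_of_forall_mem_sphere_norm_le (by norm_num) ?_ ?_
    · refine hdiff.diffContOnCl_ball fun w hw ↦ ?_
      have hw' : ‖w - c‖ ≤ 1 / 16 := by simpa [dist_eq_norm] using hw
      have h1 : ‖w - 1‖ ≤ 1 / 16 + 1 / 8 := by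
        calc ‖w - 1‖ = ‖(w - c) + (c - 1)‖ := by ring_nf
          _ ≤ ‖w - c‖ + ‖c - 1‖ := norm_add_le _ _
          _ ≤ 1 / 16 + 1 / 8 := add_le_add hw' hc'
      have h2 : |(w - 1).re| ≤ ‖w - 1‖ := abs_re_le_norm _
      show 1 / 2 < w.re
      have h3 : |w.re - 1| ≤ 1 / 16 + 1 / 8 := by simpa using h2.trans h1
      rw [abs_le] at h3
      linarith [h3.1]
    · intro w hw
      have hw' : ‖w - c‖ = 1 / 16 := by simpa [dist_eq_norm] using hw
      have h1 : ‖w - 1‖ ≤ 1 / 16 + 1 / 8 := by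
        calc ‖w - 1‖ = ‖(w - c) + (c - 1)‖ := by ring_nf
          _ ≤ ‖w - c‖ + ‖c - 1‖ := norm_add_le _ _
          _ ≤ 1 / 16 + 1 / 8 := by rw [hw']; linarith
      have h3 : |w.re - 1| ≤ 1 / 16 + 1 / 8 := by
        simpa using (abs_re_le_norm (w - 1)).trans h1
      rw [abs_le] at h3
      exact hbound w z (by linarith [h3.1]) hz
  -- differentiability on the closed ball
  have hdiffAt : ∀ c ∈ closedBall (1 : ℂ) (1 / 8), DifferentiableAt ℂ f c := by
    intro c hc
    have hc' : ‖c - 1‖ ≤ 1 / 8 := by simpa [dist_eq_norm] using hc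
    have h3 : |c.re - 1| ≤ 1 / 8 := by simpa using (abs_re_le_norm (c - 1)).trans hc'
    rw [abs_le] at h3
    exact hdiff.differentiableAt ((isOpen_lt continuous_const continuous_re).mem_nhds
      (show (1 : ℝ) / 2 < c.re by linarith [h3.1]))
  have hmv := (convex_closedBall (1 : ℂ) (1 / 8)).norm_image_sub_le_of_norm_deriv_le hdiffAt hderiv
    (mem_closedBall_self (by norm_num)) (show s ∈ closedBall (1 : ℂ) (1 / 8) by
      simpa [dist_eq_norm] using hs)
  simpa [hf] using hmv

/-! ### Entirety in `z` -/

/-- Each factor `E_p(s, ·)` is entire in `z`. [folklore] -/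
theorem differentiable_eulerFactor_param (p : Nat.Primes) (s : ℂ) :
    Differentiable ℂ (fun z : ℂ ↦ eulerFactor p s z) := by
  unfold eulerFactor
  fun_prop

/-- Locally uniform convergence of `∏_p E_p(s, z)` in `z` on every ball (`σ > 1/2`). [folklore] -/
theorem hasProdLocallyUniformlyOn_eulerFactor_param {s : ℂ} (hs : 1 / 2 < s.re) (R : ℝ) :
    HasProdLocallyUniformlyOn (fun (p : Nat.Primes) (z : ℂ) ↦ eulerFactor p s z)
      (fun z ↦ selbergF s z) (ball (0 : ℂ) R) := by
  have hK : IsOpen (ball (0 : ℂ) R) := isOpen_ball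
  have hσ : 0 < s.re := by linarith
  have hu : Summable fun p : Nat.Primes ↦ 10 * (R + R ^ 2) * ((p : ℕ) : ℝ) ^ (-(2 * s.re)) :=
    ((Nat.Primes.summable_rpow (r := -(2 * s.re))).2 (by linarith)).mul_left _
  have hev : ∀ᶠ p : Nat.Primes in cofinite, ∀ z ∈ ball (0 : ℂ) R,
      ‖eulerFactor p s z - 1‖ ≤ 10 * (R + R ^ 2) * ((p : ℕ) : ℝ) ^ (-(2 * s.re)) := by
    filter_upwards [eventually_norm_eulerFactor_sub_one_le hσ R] with p hp z hz
    exact hp s z le_rfl (by simpa using (mem_ball_zero_iff.1 hz).le)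
  have hcts : ∀ p : Nat.Primes, ContinuousOn (fun z ↦ eulerFactor p s z - 1) (ball (0 : ℂ) R) :=
    fun p ↦ ((differentiable_eulerFactor_param p s).continuous.sub continuous_const).continuousOn
  have h := Summable.hasProdLocallyUniformlyOn_one_add hK hu hev hcts
  simp only [add_sub_cancel] at h
  exact h

/-- **`z ↦ F(s, z)` is entire** (`σ > 1/2`). [cite: MontgomeryVaughan2007, §7.4.1 Exercise 3(a)] -/
theorem differentiable_selbergF_param {s : ℂ} (hs : 1 / 2 < s.re) :
    Differentiable ℂ (fun z : ℂ ↦ selbergF s z) := by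
  intro z
  set R : ℝ := ‖z‖ + 1 with hR
  have hzR : z ∈ ball (0 : ℂ) R := by simp [hR]
  have hdiff : ∀ᶠ S : Finset Nat.Primes in atTop,
      DifferentiableOn ℂ (fun z ↦ ∏ p ∈ S, eulerFactor p s z) (ball (0 : ℂ) R) := by
    refine Eventually.of_forall fun S ↦ ?_
    have e : (fun z ↦ ∏ p ∈ S, eulerFactor p s z) = ∏ p ∈ S, fun z ↦ eulerFactor p s z :=
      (Finset.prod_fn S fun p z ↦ eulerFactor p s z).symm
    rw [e]
    exact DifferentiableOn.finsetProd fun p _ ↦ (differentiable_eulerFactor_param p s).differentiableOn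
  have h := TendstoLocallyUniformlyOn.differentiableOn
    (hasProdLocallyUniformlyOn_eulerFactor_param hs R) hdiff isOpen_ball
  exact h.differentiableAt (isOpen_ball.mem_nhds hzR)

/-- `z ↦ F(s, z)` is continuous (`σ > 1/2`). [folklore] -/
theorem continuous_selbergF_param {s : ℂ} (hs : 1 / 2 < s.re) :
    Continuous (fun z : ℂ ↦ selbergF s z) :=
  (differentiable_selbergF_param hs).continuous


/-! ### The factors at `s = 1` for real `z = r`: the finite products `satheSelbergF` -/

/-- The rational factor at `s = 1`: `1 + r · p^{−1}/(1 − p^{−1}) = 1 + r/(p − 1)`. [folklore] -/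
theorem one_add_mul_inv_div_eq {p : ℝ} (hp : 1 < p) (r : ℝ) :
    1 + r * (p⁻¹ / (1 - p⁻¹)) = 1 + r / (p - 1) := by
  have hp0 : p ≠ 0 := by positivity
  have hp1 : p - 1 ≠ 0 := sub_ne_zero.2 hp.ne'
  field_simp

/-- **`E_p(1, r) = (1 + r/(p − 1))(1 − 1/p)^r`** for real `r`: the factors of `satheSelbergF`.
[cite: MontgomeryVaughan2007, §7.4.1 Exercise 3(a)] -/
theorem eulerFactor_one_ofReal (p : Nat.Primes) (r : ℝ) :
    eulerFactor p 1 (r : ℂ) =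
      (((1 + r / (((p : ℕ) : ℝ) - 1)) * (1 - 1 / ((p : ℕ) : ℝ)) ^ r : ℝ) : ℂ) := by
  have hp1 : (1 : ℝ) < ((p : ℕ) : ℝ) := by exact_mod_cast p.prop.one_lt
  have hp0 : (0 : ℝ) < ((p : ℕ) : ℝ) := by linarith
  have hpos : 0 < 1 - (((p : ℕ) : ℝ))⁻¹ := by
    rw [sub_pos]; exact inv_lt_one_of_one_lt₀ hp1
  have hq : ((p : ℕ) : ℂ) ^ (-(1 : ℂ)) = ((((p : ℕ) : ℝ)⁻¹ : ℝ) : ℂ) := by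
    rw [cpow_neg_one]; push_cast; rfl
  unfold eulerFactor
  rw [hq]
  have hlog : Complex.log (1 - ((((p : ℕ) : ℝ)⁻¹ : ℝ) : ℂ)) =
      ((Real.log (1 - (((p : ℕ) : ℝ))⁻¹) : ℝ) : ℂ) := by
    rw [← ofReal_one, ← ofReal_sub, ofReal_log hpos.le]
  rw [hlog, ← ofReal_mul, ← ofReal_exp, mul_comm r, ← Real.rpow_def_of_pos hpos]
  have hrat : (1 : ℂ) + (r : ℂ) * (((((p : ℕ) : ℝ)⁻¹ : ℝ) : ℂ) / (1 - ((((p : ℕ) : ℝ)⁻¹ : ℝ) : ℂ))) =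
      ((1 + r / (((p : ℕ) : ℝ) - 1) : ℝ) : ℂ) := by
    rw [← one_add_mul_inv_div_eq hp1 r]
    push_cast
    ring
  rw [hrat, ← ofReal_mul, one_div]

/-- The primes `≤ x` as a finset of `Nat.Primes`. [folklore] -/
theorem prod_subtype_primesLE {M : Type*} [CommMonoid M] (x : ℕ) (f : ℕ → M) :
    ∏ p ∈ (Nat.primesLE x).subtype Nat.Prime, f (p : ℕ) = ∏ p ∈ Nat.primesLE x, f p := by
  have hprime : ∀ p ∈ Nat.primesLE x, Nat.Prime p := fun p hp ↦ Nat.prime_of_mem_primesLE hp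
  conv_rhs => rw [← Finset.filter_true_of_mem hprime, ← Finset.subtype_map, Finset.prod_map]
  rfl

/-- **The partial products at `s = 1`, `z = r` real, are `satheSelbergF x r`**:
`∏_{p ≤ x} E_p(1, r) = ∏_{p ≤ x} (1 + r/(p − 1))(1 − 1/p)^r`. [cite: MontgomeryVaughan2007, §7.4.1 Exercise 3(c)] -/
theorem prod_eulerFactor_one_ofReal (x : ℕ) (r : ℝ) :
    ∏ p ∈ (Nat.primesLE x).subtype Nat.Prime, eulerFactor p 1 (r : ℂ) =
      ((satheSelbergF x r : ℝ) : ℂ) := by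
  rw [satheSelbergF, ofReal_prod, ← prod_subtype_primesLE x
    (fun p : ℕ ↦ (((1 + r / ((p : ℝ) - 1)) * (1 - 1 / (p : ℝ)) ^ r : ℝ) : ℂ))]
  exact Finset.prod_congr rfl fun p _ ↦ eulerFactor_one_ofReal p r

/-- The real factors are positive for `r ≥ 0`. [folklore] -/
theorem satheSelberg_factor_pos {p : ℕ} (hp : p.Prime) {r : ℝ} (hr : 0 ≤ r) :
    0 < (1 + r / ((p : ℝ) - 1)) * (1 - 1 / (p : ℝ)) ^ r := by
  have hp1 : (1 : ℝ) < p := by exact_mod_cast hp.one_lt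
  have h1 : 0 < 1 + r / ((p : ℝ) - 1) := by
    have : 0 ≤ r / ((p : ℝ) - 1) := div_nonneg hr (by linarith)
    linarith
  have h2 : 0 < 1 - 1 / (p : ℝ) := by
    rw [sub_pos, div_lt_one (by linarith)]; exact hp1
  exact mul_pos h1 (Real.rpow_pos_of_pos h2 r)

/-- `satheSelbergF x r > 0` for `r ≥ 0`. [folklore] -/
theorem satheSelbergF_pos (x : ℕ) {r : ℝ} (hr : 0 ≤ r) : 0 < satheSelbergF x r := by
  rw [satheSelbergF]
  exact Finset.prod_pos fun p hp ↦ satheSelberg_factor_pos (Nat.prime_of_mem_primesLE hp) hr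

/-! ### Splitting off the primes `≤ x`: the tail product -/

/-- **Splitting the Euler product**: for a finite set `S` of primes,
`F(1, z) = (∏_{p ∈ S} E_p(1, z)) · ∏'_p 𝟙_{p ∉ S} E_p(1, z)`, and the tail product is within
`exp(∑_{p ∉ S} ‖E_p(1, z) − 1‖) − 1` of `1`. More precisely, for any summable majorant `η` of
`∑_{p ∉ S} ‖E_p(1,z) − 1‖`: `‖F(1,z) − ∏_{p∈S} E_p(1,z)‖ ≤ ‖∏_{p∈S} E_p(1,z)‖ (exp η − 1)`.
[cite: MontgomeryVaughan2007, §7.4.1 Exercise 3(a)] -/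
theorem norm_selbergF_sub_prod_le {s : ℂ} (hs : 1 / 2 < s.re) (z : ℂ) (S : Finset Nat.Primes)
    {η : ℝ} (hη : ∑' p : Nat.Primes, ‖(↑S : Set Nat.Primes)ᶜ.indicator
      (fun p ↦ eulerFactor p s z - 1) p‖ ≤ η) :
    ‖selbergF s z - ∏ p ∈ S, eulerFactor p s z‖ ≤
      ‖∏ p ∈ S, eulerFactor p s z‖ * (Real.exp η - 1) := by
  classical
  set f : Nat.Primes → ℂ := fun p ↦ eulerFactor p s z with hf
  set a : Nat.Primes → ℂ := (↑S : Set Nat.Primes)ᶜ.indicator (fun p ↦ f p - 1) with ha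
  -- summability of the tail perturbation
  have hsum : Summable fun p ↦ ‖a p‖ := by
    have h := (summable_norm_eulerFactor_sub_one z hs).indicator ((↑S : Set Nat.Primes)ᶜ)
    exact h.congr fun p ↦ (norm_indicator_eq_indicator_norm _ _).symm
  -- the finite part
  have hfin : HasProd ((↑S : Set Nat.Primes).mulIndicator f) (∏ p ∈ S, f p) := by
    have h : HasProd ((↑S : Set Nat.Primes).mulIndicator f)
        (∏ p ∈ S, (↑S : Set Nat.Primes).mulIndicator f p) :=
      hasProd_prod_of_ne_finset_one (fun p hp ↦ Set.mulIndicator_of_notMem (by simpa using hp) f)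
    rwa [Finset.prod_congr rfl (fun p hp ↦ Set.mulIndicator_of_mem (Finset.mem_coe.2 hp) f)] at h
  -- the tail part
  have htail_eq : (↑S : Set Nat.Primes)ᶜ.mulIndicator f = fun p ↦ 1 + a p := by
    funext p
    simp only [ha, Set.mulIndicator_apply, Set.indicator_apply, Set.mem_compl_iff, Finset.mem_coe]
    split_ifs <;> ring
  have hmult : Multipliable fun p ↦ 1 + a p := multipliable_one_add_of_summable hsum
  have htail : HasProd ((↑S : Set Nat.Primes)ᶜ.mulIndicator f) (∏' p, (1 + a p)) := by
    rw [htail_eq]; exact hmult.hasProd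
  -- product of the two
  have hprod := hfin.mul htail
  simp only [Set.mulIndicator_self_mul_compl_apply] at hprod
  have hF : selbergF s z = (∏ p ∈ S, f p) * ∏' p, (1 + a p) :=
    (hasProd_selbergF z hs).unique hprod
  -- the tail product is close to `1`
  have hT : ‖∏' p, (1 + a p) - 1‖ ≤ Real.exp η - 1 := by
    have hlim : Tendsto (fun U : Finset Nat.Primes ↦ ‖∏ p ∈ U, (1 + a p) - 1‖) atTop
        (𝓝 ‖∏' p, (1 + a p) - 1‖) :=
      ((continuous_norm.comp (continuous_sub_right (1 : ℂ))).tendsto _).comp hmult.hasProd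
    refine le_of_tendsto' hlim fun U ↦ ?_
    calc ‖∏ p ∈ U, (1 + a p) - 1‖ ≤ Real.exp (∑ p ∈ U, ‖a p‖) - 1 :=
          Finset.norm_prod_one_add_sub_one_le U a
      _ ≤ Real.exp η - 1 := by
          gcongr
          exact (sum_le_hasSum U (fun p _ ↦ norm_nonneg _) hsum.hasSum).trans hη
  calc ‖selbergF s z - ∏ p ∈ S, f p‖ = ‖(∏ p ∈ S, f p) * (∏' p, (1 + a p) - 1)‖ := by
        rw [hF]; ring_nf
    _ = ‖∏ p ∈ S, f p‖ * ‖∏' p, (1 + a p) - 1‖ := norm_mul _ _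
    _ ≤ ‖∏ p ∈ S, f p‖ * (Real.exp η - 1) := by gcongr

/-- `p^{-2} ≤ x^{-1/2} p^{-3/2}` for `p > x ≥ 1`. [folklore] -/
theorem rpow_neg_two_le {p x : ℝ} (hx : 1 ≤ x) (hpx : x < p) :
    p ^ (-(2 : ℝ)) ≤ x ^ (-(1 / 2 : ℝ)) * p ^ (-(3 / 2 : ℝ)) := by
  have hp : 0 < p := by linarith
  have hx0 : 0 < x := by linarith
  rw [show (-(2 : ℝ)) = -(1 / 2 : ℝ) + -(3 / 2 : ℝ) by norm_num, Real.rpow_add hp]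
  exact mul_le_mul_of_nonneg_right (Real.rpow_le_rpow_of_nonpos hx0 hpx.le (by norm_num))
    (Real.rpow_nonneg hp.le _)

/-- **The tail bound**: for every `R` there are `C` and `x₀` such that for `x ≥ x₀` and `‖z‖ ≤ R`,
`‖F(1, z) − ∏_{p ≤ x} E_p(1, z)‖ ≤ ‖∏_{p ≤ x} E_p(1, z)‖ · C x^{−1/2}` (since
`∑_{p > x} ‖E_p(1,z) − 1‖ ≤ 10(R + R²) ∑_{p > x} p^{−2} ≤ 10(R+R²)(∑_p p^{−3/2}) x^{−1/2}`).
[cite: MontgomeryVaughan2007, §7.4.1 Exercise 3(a)] -/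
theorem exists_norm_selbergF_one_sub_prod_le (R : ℝ) :
    ∃ C : ℝ, 0 ≤ C ∧ ∃ x₀ : ℕ, ∀ x : ℕ, x₀ ≤ x → ∀ z : ℂ, ‖z‖ ≤ R →
      ‖selbergF 1 z - ∏ p ∈ (Nat.primesLE x).subtype Nat.Prime, eulerFactor p 1 z‖ ≤
        ‖∏ p ∈ (Nat.primesLE x).subtype Nat.Prime, eulerFactor p 1 z‖ *
          (C * (x : ℝ) ^ (-(1 / 2 : ℝ))) := by
  classical
  have hev := eventually_norm_eulerFactor_sub_one_le (by norm_num : (0 : ℝ) < 1) R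
  rw [Filter.eventually_cofinite] at hev
  set E : Finset Nat.Primes := hev.toFinset with hE
  -- `x₀`: beyond all exceptional primes, and `≥ 1`
  set x₀ : ℕ := max 1 (E.sup fun p ↦ (p : ℕ)) with hx₀
  have hS32 : Summable fun p : Nat.Primes ↦ ((p : ℕ) : ℝ) ^ (-(3 / 2 : ℝ)) :=
    (Nat.Primes.summable_rpow (r := -(3 / 2 : ℝ))).2 (by norm_num)
  set S32 : ℝ := ∑' p : Nat.Primes, ((p : ℕ) : ℝ) ^ (-(3 / 2 : ℝ)) with hS32def
  have hS32nn : 0 ≤ S32 := tsum_nonneg fun p ↦ Real.rpow_nonneg (Nat.cast_nonneg _) _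
  set K : ℝ := |10 * (R + R ^ 2)| * S32 with hK
  have hK0 : 0 ≤ K := by positivity
  -- `exp η − 1 ≤ η exp η ≤ η exp K` for `0 ≤ η ≤ K`
  refine ⟨K * Real.exp K, by positivity, x₀, fun x hx z hz ↦ ?_⟩
  have hx1 : (1 : ℝ) ≤ x := by exact_mod_cast le_trans (le_max_left _ _) hx
  set S : Finset Nat.Primes := (Nat.primesLE x).subtype Nat.Prime with hSdef
  -- primes outside `S` are `> x`, hence not exceptional
  have hout : ∀ p : Nat.Primes, p ∉ S → x < (p : ℕ) := by
    intro p hp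
    by_contra h
    push Not at h
    exact hp (Finset.mem_subtype.2 (Nat.mem_primesLE.2 ⟨h, p.prop⟩))
  have hgood : ∀ p : Nat.Primes, p ∉ S →
      ‖eulerFactor p 1 z - 1‖ ≤ 10 * (R + R ^ 2) * ((p : ℕ) : ℝ) ^ (-(2 * (1 : ℝ))) := by
    intro p hp
    have hpE : p ∉ E := by
      intro hpE
      have h1 : (p : ℕ) ≤ E.sup fun p ↦ (p : ℕ) := Finset.le_sup (f := fun p : Nat.Primes ↦ (p : ℕ)) hpE
      have h2 : E.sup (fun p ↦ (p : ℕ)) ≤ x₀ := le_max_right _ _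
      have := hout p hp
      omega
    have hpE' : ¬ ¬ (∀ s z : ℂ, (1 : ℝ) ≤ s.re → ‖z‖ ≤ R →
        ‖eulerFactor p s z - 1‖ ≤ 10 * (R + R ^ 2) * ((p : ℕ) : ℝ) ^ (-(2 * (1 : ℝ)))) := by
      rwa [hE, Set.Finite.mem_toFinset] at hpE
    push Not at hpE'
    exact hpE' 1 z (by simp) hz
  -- the majorant
  set η : ℝ := K * (x : ℝ) ^ (-(1 / 2 : ℝ)) with hηdef
  have hη0 : 0 ≤ η := by positivity
  have hηK : η ≤ K := by
    have : (x : ℝ) ^ (-(1 / 2 : ℝ)) ≤ 1 := Real.rpow_le_one_of_one_le_of_nonpos hx1 (by norm_num)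
    calc η = K * (x : ℝ) ^ (-(1 / 2 : ℝ)) := rfl
      _ ≤ K * 1 := by gcongr
      _ = K := mul_one K
  have hbound : ∑' p : Nat.Primes, ‖(↑S : Set Nat.Primes)ᶜ.indicator
      (fun p ↦ eulerFactor p 1 z - 1) p‖ ≤ η := by
    have hterm : ∀ p : Nat.Primes, ‖(↑S : Set Nat.Primes)ᶜ.indicator
        (fun p ↦ eulerFactor p 1 z - 1) p‖ ≤
        |10 * (R + R ^ 2)| * ((x : ℝ) ^ (-(1 / 2 : ℝ)) * ((p : ℕ) : ℝ) ^ (-(3 / 2 : ℝ))) := by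
      intro p
      by_cases hp : p ∈ S
      · rw [Set.indicator_of_notMem (by simpa using hp)]
        simp only [norm_zero]
        positivity
      · rw [Set.indicator_of_mem (by simpa using hp)]
        have hxp : (x : ℝ) < ((p : ℕ) : ℝ) := by exact_mod_cast hout p hp
        calc ‖eulerFactor p 1 z - 1‖ ≤ 10 * (R + R ^ 2) * ((p : ℕ) : ℝ) ^ (-(2 * (1 : ℝ))) :=
              hgood p hp
          _ ≤ |10 * (R + R ^ 2)| * ((p : ℕ) : ℝ) ^ (-(2 * (1 : ℝ))) :=
              mul_le_mul_of_nonneg_right (le_abs_self _) (Real.rpow_nonneg (Nat.cast_nonneg _) _)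
          _ ≤ |10 * (R + R ^ 2)| * ((x : ℝ) ^ (-(1 / 2 : ℝ)) * ((p : ℕ) : ℝ) ^ (-(3 / 2 : ℝ))) := by
              gcongr
              rw [show (2 * (1 : ℝ)) = 2 by norm_num]
              exact rpow_neg_two_le hx1 hxp
    have hsumR : Summable fun p : Nat.Primes ↦
        |10 * (R + R ^ 2)| * ((x : ℝ) ^ (-(1 / 2 : ℝ)) * ((p : ℕ) : ℝ) ^ (-(3 / 2 : ℝ))) :=
      (hS32.mul_left _).mul_left _
    have hsumL : Summable fun p : Nat.Primes ↦ ‖(↑S : Set Nat.Primes)ᶜ.indicator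
        (fun p ↦ eulerFactor p 1 z - 1) p‖ :=
      Summable.of_nonneg_of_le (fun p ↦ norm_nonneg _) hterm hsumR
    calc ∑' p : Nat.Primes, ‖(↑S : Set Nat.Primes)ᶜ.indicator (fun p ↦ eulerFactor p 1 z - 1) p‖
        ≤ ∑' p : Nat.Primes, |10 * (R + R ^ 2)| * ((x : ℝ) ^ (-(1 / 2 : ℝ)) *
            ((p : ℕ) : ℝ) ^ (-(3 / 2 : ℝ))) := hsumL.tsum_le_tsum hterm hsumR
      _ = |10 * (R + R ^ 2)| * ((x : ℝ) ^ (-(1 / 2 : ℝ)) * S32) := by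
          rw [tsum_mul_left, tsum_mul_left]
      _ = η := by rw [hηdef, hK]; ring
  have hmain := norm_selbergF_sub_prod_le (by norm_num : (1 : ℝ) / 2 < (1 : ℂ).re) z S hbound
  refine hmain.trans (mul_le_mul_of_nonneg_left ?_ (norm_nonneg _))
  -- `exp η − 1 ≤ η exp η ≤ η exp K = (K exp K)·… ≤ K e^K x^{-1/2}`
  have h1 : Real.exp η - 1 ≤ η * Real.exp η := by
    have := Real.add_one_le_exp (-η)
    have hexp : Real.exp (-η) * Real.exp η = 1 := by rw [← Real.exp_add]; simp
    nlinarith [Real.exp_pos η]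
  calc Real.exp η - 1 ≤ η * Real.exp η := h1
    _ ≤ η * Real.exp K := by gcongr
    _ = K * Real.exp K * (x : ℝ) ^ (-(1 / 2 : ℝ)) := by rw [hηdef]; ring

/-! ### `F(1, r)` is a positive real for real `r ≥ 0` -/

/-- The partial products at `s = 1`, real `r ≥ 0`, converge to `F(1, r)`. [folklore] -/
theorem tendsto_satheSelbergF (r : ℝ) :
    Tendsto (fun x : ℕ ↦ ((satheSelbergF x r : ℝ) : ℂ)) atTop (𝓝 (selbergF 1 r)) := by
  obtain ⟨C, hC, x₀, h⟩ := exists_norm_selbergF_one_sub_prod_le ‖(r : ℂ)‖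
  obtain ⟨B, hB, hBd⟩ := exists_bound_selbergF (by norm_num : (1 : ℝ) / 2 < 3 / 4) ‖(r : ℂ)‖
  rw [Metric.tendsto_atTop]
  intro ε hε
  -- `‖∏_{p ≤ x} E_p(1, r)‖ ≤ 2 B` eventually, and `C x^{-1/2} → 0`
  have hlim : Tendsto (fun x : ℕ ↦ C * (x : ℝ) ^ (-(1 / 2 : ℝ))) atTop (𝓝 0) := by
    have := (tendsto_rpow_neg_atTop (by norm_num : (0 : ℝ) < 1 / 2)).comp tendsto_natCast_atTop_atTop
    simpa using this.const_mul C
  have hδ : 0 < min (1 / 2 : ℝ) (ε / (2 * (B + 1))) := lt_min (by norm_num) (by positivity)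
  obtain ⟨x₁, hx₁⟩ := (Metric.tendsto_atTop.1 hlim) _ hδ
  refine ⟨max x₀ x₁, fun x hx ↦ ?_⟩
  have hx0 : x₀ ≤ x := le_trans (le_max_left _ _) hx
  have hxx₁ : x₁ ≤ x := le_trans (le_max_right _ _) hx
  have hsmall := hx₁ x hxx₁
  rw [Real.dist_eq, sub_zero, abs_of_nonneg (by positivity)] at hsmall
  have hs1 := (lt_min_iff.1 hsmall).1
  have hs2 := (lt_min_iff.1 hsmall).2
  have hmain := h x hx0 r le_rfl
  rw [prod_eulerFactor_one_ofReal] at hmain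
  set P : ℂ := ((satheSelbergF x r : ℝ) : ℂ) with hP
  -- `‖P‖ ≤ ‖F(1,r)‖ + ‖F(1,r) − P‖ ≤ B + ‖P‖/2`, so `‖P‖ ≤ 2B`
  have hF : ‖selbergF 1 r‖ ≤ B := hBd 1 r (by norm_num) le_rfl
  have hPB : ‖P‖ ≤ 2 * B := by
    have h1 : ‖P‖ ≤ ‖selbergF 1 r‖ + ‖selbergF 1 r - P‖ := norm_le_insert _ _
    have h2 : ‖selbergF 1 ↑r - P‖ ≤ ‖P‖ * (1 / 2) :=
      hmain.trans (mul_le_mul_of_nonneg_left hs1.le (norm_nonneg _))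
    linarith
  rw [dist_comm, dist_eq_norm]
  calc ‖selbergF 1 r - P‖ ≤ ‖P‖ * (C * (x : ℝ) ^ (-(1 / 2 : ℝ))) := hmain
    _ ≤ 2 * B * (ε / (2 * (B + 1))) := mul_le_mul hPB hs2.le (by positivity) (by positivity)
    _ < ε := by
        rw [show 2 * B * (ε / (2 * (B + 1))) = ε * (B / (B + 1)) by field_simp]
        have : B / (B + 1) < 1 := by rw [div_lt_one (by positivity)]; linarith
        nlinarith

/-- **`F(1, r)` is real for real `r`** (a limit of the real partial products). [folklore] -/
theorem selbergF_one_ofReal_im (r : ℝ) : (selbergF 1 r).im = 0 := by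
  have h := tendsto_satheSelbergF r
  have him : Tendsto (fun x : ℕ ↦ (((satheSelbergF x r : ℝ) : ℂ)).im) atTop (𝓝 (selbergF 1 r).im) :=
    (continuous_im.tendsto _).comp h
  simp only [ofReal_im] at him
  exact tendsto_nhds_unique tendsto_const_nhds him |>.symm

/-- `F(1, r) ≠ 0` for real `r ≥ 0` (an absolutely convergent product of non-zero factors). [folklore] -/
theorem selbergF_one_ofReal_ne_zero {r : ℝ} (hr : 0 ≤ r) : selbergF 1 r ≠ 0 := by
  have hsum := summable_norm_eulerFactor_sub_one (r : ℂ) (by norm_num : (1 : ℝ) / 2 < (1 : ℂ).re)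
  have hne : ∀ p : Nat.Primes, 1 + (eulerFactor p 1 r - 1) ≠ 0 := by
    intro p
    rw [add_sub_cancel, eulerFactor_one_ofReal]
    exact ofReal_ne_zero.2 (satheSelberg_factor_pos p.prop hr).ne'
  have h := tprod_one_add_ne_zero_of_summable hne hsum
  simp only [add_sub_cancel] at h
  rwa [selbergF]

/-- **`F(1, r) > 0` for real `r ≥ 0`.** [cite: MontgomeryVaughan2007, §7.4.1 Exercise 3(d)] -/
theorem selbergF_one_ofReal_re_pos {r : ℝ} (hr : 0 ≤ r) : 0 < (selbergF 1 r).re := by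
  have h := tendsto_satheSelbergF r
  have hre : Tendsto (fun x : ℕ ↦ (((satheSelbergF x r : ℝ) : ℂ)).re) atTop (𝓝 (selbergF 1 r).re) :=
    (continuous_re.tendsto _).comp h
  simp only [ofReal_re] at hre
  have hge : 0 ≤ (selbergF 1 r).re :=
    ge_of_tendsto' hre fun x ↦ (satheSelbergF_pos x hr).le
  rcases hge.lt_or_eq with hlt | heq
  · exact hlt
  · exfalso
    apply selbergF_one_ofReal_ne_zero hr
    exact Complex.ext (by simpa using heq.symm) (by simpa using selbergF_one_ofReal_im r)

/-- `F(1, r) = Re F(1, r)` as a complex number, for real `r`. [folklore] -/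
theorem selbergF_one_ofReal_eq (r : ℝ) : selbergF 1 r = (((selbergF 1 r).re : ℝ) : ℂ) :=
  Complex.ext (by simp) (by simp [selbergF_one_ofReal_im r])

/-- **Uniform positivity on `[0, R]`**: there is `m > 0` with `m ≤ Re F(1, r)` for `0 ≤ r ≤ R`
(continuity of the entire function `z ↦ F(1, z)` on the compact interval).
[cite: MontgomeryVaughan2007, §7.4.1 Exercise 3(d)] -/
theorem exists_pos_le_selbergF_one_re {R : ℝ} (hR : 0 ≤ R) :
    ∃ m : ℝ, 0 < m ∧ ∀ r : ℝ, 0 ≤ r → r ≤ R → m ≤ (selbergF 1 r).re := by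
  have hcont : ContinuousOn (fun r : ℝ ↦ (selbergF 1 r).re) (Set.Icc 0 R) :=
    (continuous_re.comp ((continuous_selbergF_param (by norm_num : (1 : ℝ) / 2 < (1 : ℂ).re)).comp
      continuous_ofReal)).continuousOn
  obtain ⟨r₀, hr₀, hmin⟩ := (isCompact_Icc (a := (0 : ℝ)) (b := R)).exists_isMinOn
    ⟨0, Set.left_mem_Icc.2 hR⟩ hcont
  refine ⟨(selbergF 1 r₀).re, selbergF_one_ofReal_re_pos hr₀.1, fun r hr0 hrR ↦ ?_⟩
  exact hmin ⟨hr0, hrR⟩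

end SatheSelberg

end Literature.NumberTheory.LFunctions
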